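import Summits.SmoothPoincare4.SmoothPoincare4.Theses.ZeroSurgeryExotic
import Summits.SmoothPoincare4.SmoothPoincare4.Theorems.ZeroSurgeryExoticZseThesisOfCruxRasmussen
import Literature.Uncategorized.Crux
import Literature.Topology.FourManifolds.RasmussenSliceProofs
import Literature.Topology.FourManifolds.LeeRasmussenAntiBigonProofs
import Literature.Topology.FourManifolds.RasmussenWellDefinedR
import Literature.Topology.FourManifolds.GaussDiagramsRegularPosition
import Literature.Topology.FourManifolds.SliceRibbonIsotopyProofs
import Literature.Topology.FourManifolds.KnotsProofs
import HarnessLib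

/-!
# Line `Sketch` for crux `ZeroSurgeryExotic.ZseThesis` (stmt-SmoothPoincare4-0364) — skeleton v3 (lead c3, 2026-08-17)

Skeleton of the line cut by lead c0 from the ideator-2 sketch `Cruxes/ZseThesis/SketchIdeator2.lean` (cards
`refined-tier-bph-test` = the Transfer, `montesinos-band-engine`, `property-r-refill` = K-side engines; triage r1: pass ×2,
merged with `bph-blind-spot-witness` ≈ `sandwich-slack`), reshaped by lead c2 (v2: `stub_hit` retyped to `stub_crux`) and by
lead c3 (this file, v3: `stub_sliceVanishing` SPLIT into `stub_reidemeisterR` + `stub_sliceHasZero`, composed through the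
REquiv-invariance of `s` landed by c3 — `GaussDiagram.rasmussenInvariant_eq_of_rEquiv_diagram`, LeeRasmussenAntiBigonProofs.lean;
v2 = `Lines/Sketch.lean` @ sha 38abb6ff…, kept byte-identical in the lead folder as `work/ZseThesis.v2.lean`).

## The crux

`ZseThesis : ∃ K K' Y, IsIntegralSurgery (𝓡 3) Y K 0 ∧ IsIntegralSurgery (𝓡 3) Y K' 0 ∧ K.IsSmoothlySlice ∧
¬ K'.IsSmoothlySlice` — the route's TARGET (auto-crux): a smoothly slice knot with a non-slice `0`-friend. With the
PROVED assembly (`Theorems/ZeroSurgeryExoticAssembly.lean`) a proof is a Lean disproof of `SmoothPoincare4`.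

## The line in one paragraph (unchanged composition idea)

A witness is a `0`-surgery pair `(K, K', Y)` with `K` smoothly slice plus a `B⁴`-sliceness obstruction on `K'` that does
NOT factor through homotopy-ball sliceness (Disproof §3b: the partner of any witness is slice in a homotopy 4-ball —
Manolescu–Piccirillo Lemma 3.3, PROVED — hence topologically slice mod Freedman, so every algebraic / gauge-theoretic
homology-concordance obstruction is blind); in print and in the tree the only such obstruction is Khovanov-type, and the
tree's concrete one is Rasmussen's `s` (`Knot.HasRasmussenInvariant`, ℚ-Lee homology of Gauss diagrams). So the line is

  `stub_crux` (an `s`-WITNESSED pair: `Y` common `0`-surgery, `K` smoothly slice, `s(K') ≠ 0`)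
  `+ stub_sliceHasZero` (witness-tier soundness in the form a movie proof produces: every smoothly slice knot has SOME
  isotopic representative with SOME regular projection reading `s = 0` — Rasmussen 2010 Thm 1 with a free representative)
  `+ stub_reidemeisterR` (Reidemeister 1927 / Polyak 2010 Thm 1.2, Gauss-diagram form, direction `→`, read on regular
  projections: projections of isotopic knots are `REquiv`-related)
  `⟹ sliceVanishing_of_stubs` (every projection of a slice knot reads `s = 0`, by the PROVED invariance of `s` under `REquiv`
  between realisable diagrams) `⟹ ZseThesis_of`.

## What v3 changes and why (lead c3)

* v2's `stub_sliceVanishing : ∀ K (P : K.RegularProjection), K.IsSmoothlySlice → P.diagram.rasmussenInvariant = 0` (⟺ the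
  named fact `eq_zero_of_isSmoothlySlice`; answered `stub-blocked` by four workers) is now a THEOREM of two registered stubs:
  `stub_reidemeisterR ∧ stub_sliceHasZero → sliceVanishing` (`sliceVanishing_of_stubs`), the glue being
  `GaussDiagram.rasmussenInvariant_eq_of_rEquiv_diagram` — invariance of `s` under ALL oriented Reidemeister moves between
  realisable Gauss diagrams, landed by this lead (KhAntiBigon* p162757/p163282/p163649/p163833/p164141, GaussDiagramParityRMoves
  p163022, LeeRasmussenAntiBigonProofs p164437): the anti-parallel second move `Ω2c/Ω2d` was missing from the tree's move set.
* Why this is an honest split and not a costume: `stub_sliceHasZero` is WEAKER than v2's stub (`sliceHasZero_of_sliceVanishing`)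
  — it lets the proof choose the representative and the projection, which is exactly what putting a slice disc in Morse
  position and reading a generic projection yields (the cobordism debt: link Gauss diagrams + Lee cube, Morse-move maps,
  Rasmussen Prop 4.1, movie presentation); `stub_reidemeisterR` is Reidemeister's theorem (the 1-parameter genericity debt),
  which any proof of v2's stub for a FIXED projection `P` had to contain anyway; neither alone implies the crux or v2's stub.
  It is the `→` half of the named fact `Knot.reidemeisterR` (RasmussenWellDefinedR.lean, p164999, review) read on projections.
* Sizes: both XL (classical theorems; not session-closable) — the point of v3 is that the Reidemeister debt and the cobordism
  debt are now separately registered, separately citable obligations, and that the landed brick is load-bearing in the skeleton.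

## What v2 changes and why (lead c2)

* `stub_hit` (v1: `∃ K K' Y G', … ∧ K.IsRibbon ∧ K'.HasGaussDiagram G' ∧ G'.rasmussenInvariant ≠ 0`) is RETYPED to
  `stub_crux : Literature.Uncategorized.Crux` — the sibling crux stmt-SmoothPoincare4-0366 (`ZseCruxRasmussen`) VERBATIM.
  (a) v1 over-strengthened the hit: it demanded `K` RIBBON (slice ⇒ ribbon is the open slice-ribbon conjecture; the crux
  needs only `K.IsSmoothlySlice`) and a Gauss diagram of `K'` itself rather than the knot-level `HasRasmussenInvariant`
  (harmless but needless); `crux_of_hit` below records v1 ⇒ v2, the converse is not available. (b) INTERFACE: the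
  registered live line of 0366 (`lz-transport-theta-window`, 2026-08-17T02:15Z) concludes `Crux` BY NAME, so its
  landing discharges `stub_crux` by import — it would not have discharged v1. (c) Nothing is lost: a certificate-form
  hit (ribbon disc + Gauss diagram) still enters through `crux_of_hit`.
* `stub_sliceVanishing` was unchanged in v2 (⟺ `eq_zero_of_isSmoothlySlice`, both directions below); v3 splits it (above).
* The composition is now literally the LANDED bridge `Theorems/ZeroSurgeryExoticZseThesisOfCruxRasmussen.lean`
  (p86880, `zseThesis_of_crux_of_eq_zero_of_isSmoothlySlice`): after v2 this skeleton has no content of its own —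
  stub 1 IS item 0366, stub 2 IS the named fact — which is the lead's evidence that 0364 is a DERIVED target
  (0366 ∧ `eq_zero_of_isSmoothlySlice` → 0364) and should be restated as such by the planner.

## Disproof used (`Cruxes/ZseThesis/Disproof.lean`, cdisprove v2, re-read 2026-08-17T06:00Z)

* no `_false_without_<H>` theorem, no `-- Targets` section; §4 (`zseThesis_without_slice_iff`, `_without_commonSurgery_iff`,
  `_without_surgeryRight_iff`, §2 `zseThesis_without_nonslice`): every conjunct load-bearing — `stub_crux` carries all of
  `Y ×2`, `K` slice, and the `s`-witness; stubs 2 + 3 (`sliceVanishing_of_stubs`) turn the witness into the fourth conjunct.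
* §1b `zseThesis_of_crux (hR : eq_zero_of_isSmoothlySlice) (h : Crux) : ZseThesis` — the disprover's own statement of this
  composition (same two hypotheses): the reshape aligns the skeleton with it.
* §3/§3d dead witness shapes (same / isotopic / mirror / reverse / inverse / concordant partner): honoured — `K'` is certified
  NON-slice (`hit_partner_not_isSmoothlySlice`), so no symmetric image of `K` can be the partner.
* §3b certification barrier (`zseThesis_hballWitness_false`, `zseThesis_topWitness_false_of_freedman`): the reason the
  witness tier is Khovanov-type; `s`'s homotopy-ball blindness is MMSW Q9.11 (open) = the bet of `stub_crux`
  (`Literature.Uncategorized.SVanishesOnPairs` is literally `¬ Crux`).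
* §6/§6b near-misses (`Assembly2` open; ribbon case ⇐ `NoohGscStandard`): nothing obstructs the stubs; v2 no longer forces
  the ribbon case.
* landed negatives `Theorems/ZseThesis/Negative/{Position,ReverseClosure,UnknotSeed}.lean`: consistent with the typing
  (they exclude degenerate witnesses, all of which have `K'` slice).

## Typing policy

Everything is stated over existing declarations: `Knot`, `IsIntegralSurgery` (`DehnSurgery.lean`), `Knot.IsSmoothlySlice`,
`Knot.IsRibbon` (`SliceRibbon.lean`), `Knot.RegularProjection`, `Knot.HasGaussDiagram` (`GaussDiagrams.lean`),
`GaussDiagram.rasmussenInvariant`, `Knot.HasRasmussenInvariant` (`LeeRasmussen.lean`), `eq_zero_of_isSmoothlySlice`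
(`Rasmussen.lean`, named fact), `Literature.Uncategorized.Crux` (the gate's transcription of item 0366). No definition
is introduced.
-/

noncomputable section

-- the prescribed namespace `Summit.<P>.<Sub>.…` duplicates `SmoothPoincare4` (P = Sub)
set_option linter.dupNamespace false

open scoped Manifold ContDiff
open Set Function
open Literature.Topology.FourManifolds Literature.Uncategorized
open Summit.SmoothPoincare4.SmoothPoincare4.Theses.ZeroSurgeryExotic

namespace Summit.SmoothPoincare4.SmoothPoincare4.Cruxes.ZseThesis.Sketch

/-- Local notation: `𝔼 n` is `EuclideanSpace ℝ (Fin n)`. -/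
local notation "𝔼 " n:arg => EuclideanSpace ℝ (Fin n)

/-! ### The stubs -/

/-- **stub 1 (load-bearing, hardest; the SEARCH) — an `s`-witnessed `0`-surgery pair.** Knots `K, K'` with a common
`0`-surgery `Y` (`IsIntegralSurgery (𝓡 3) Y K 0` and `… Y K' 0` — in print produced by an RBG link, Manolescu–Piccirillo
2023 Thm 1.2, by annulus twisting, or by satellite / monodromy constructions), `K` smoothly slice (in practice certified
by a ribbon disc), and `K'` of non-zero Rasmussen invariant (`K'.HasRasmussenInvariant s`, `s ≠ 0`: an honest ℚ-Lee
computation on a regular projection of a knot isotopic to `K'`). This is VERBATIM the sibling crux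
stmt-SmoothPoincare4-0366 (`Literature.Uncategorized.Crux`, `@[conjecture]`, open): its registered live line
`lz-transport-theta-window` (apex `K_G(-4,1,0,-1,2,1)[-T(2,3)]` ribbon) concludes `Crux` by name and discharges this
stub on landing. Why it might fail: open-problem strength — a hit disproves `SmoothPoincare4` (`not_smoothPoincare4_of_crux`);
"no pairs (K, K′) with the above properties have been found" (Manolescu, arXiv:2601.05425 p. 24); every printed supply
collapsed (MP's 5 knots non-slice, Nakamura 2023 Thm 1.1; `s` forced to vanish on (super-)special RBG families, Nakamura
Thm 3.13 / Dunfield–Gong 2025 Thm 5.9; X_DG standard, Oliveira–Smith 2026); `s` may be homotopy-ball blind (MMSW Q9.11,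
whose 0-surgery-pair restriction `SVanishesOnPairs` is literally `¬ Crux`). Size: open problem (= item 0366).
[cite: ManolescuPiccirillo2023, §1 p. 1 and Remark 1.5] -/
theorem stub_crux : Crux := by
  sorry

/-- **stub 2 (Reidemeister's theorem for knots, Gauss-diagram form, direction `→`, read on regular projections;
Reidemeister 1927 + Polyak 2010 Thm 1.2).** If the knots `K, K'` are ambient isotopic then the Gauss diagrams of any two
of their regular projections are related by the moves of `GaussDiagram.RMove` and their inverses (`GaussDiagram.REquiv`:
Polyak's moves together with the anti-parallel second moves `Ω2c/Ω2d`; chains may pass through non-realisable diagrams).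
This is the `→` half of the named fact `Knot.reidemeisterR` (RasmussenWellDefinedR.lean) specialised to projections
(`stub_reidemeisterR_of_reidemeisterR` below); the content is 1-parameter
genericity of the stereographic plane curve along an ambient isotopy (finitely many tangency / self-tangency /
triple-point events, each an `RMove`), of which the tree has only the 0-parameter case
(`Knot.exists_hasGaussDiagram_of_isIsotopic_holds`). Why plausibly true: it is Reidemeister's theorem. Size: XL.
[cite: Reidemeister1927] -/
theorem stub_reidemeisterR :
    ∀ {K K' : Knot} (P : K.RegularProjection) (P' : K'.RegularProjection),
      K.IsIsotopic K' → P.diagram.REquiv P'.diagram := by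
  sorry

/-- **stub 3 (Rasmussen 2010, Thm 1, slice case, with a free representative).** Every smoothly slice knot has
knot-level Rasmussen invariant `0`: SOME knot isotopic to it has SOME regular projection whose Gauss diagram reads `s = 0`
(`Knot.HasRasmussenInvariant K 0`). This is the form a movie proof delivers (choose the representative with the slice disc
in Morse position for the radial height and a projection generic along the movie; the concordance to the unknot then reads
as elementary cobordisms whose Lee maps are filtered of degree `0` in total and class-injective, Rasmussen §4, feeding
`eq_zero_of_isSmoothlySlice_of_filtered` / `_of_canonical`). It is WEAKER than v2's `stub_sliceVanishing`
(`sliceHasZero_of_sliceVanishing`) and than the named fact `eq_zero_of_isSmoothlySlice` (which additionally contains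
uniqueness of `s`, i.e. stub 2). What is missing in the tree: multi-component (link) Gauss diagrams and their Lee cube,
Morse-move chain maps (birth/death/saddle), Rasmussen Prop 4.1, the movie presentation of `Knot.IsSliceDisc`. Why plausibly
true: it is Rasmussen's theorem. Size: XL. [cite: Rasmussen2010, Thm. 1] -/
theorem stub_sliceHasZero : ∀ K : Knot, K.IsSmoothlySlice → K.HasRasmussenInvariant 0 := by
  sorry

/-! ### The two stubs give v2's `stub_sliceVanishing` (glue: REquiv-invariance of `s`, landed by lead c3) -/

/-- **Every regular projection of a smoothly slice knot reads `s = 0`** (v2's `stub_sliceVanishing`, now a theorem of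
stubs 2 and 3): stub 3 gives an isotopic `K'` with a projection `P'` reading `0`; stub 2 relates `P.diagram` and
`P'.diagram` by `REquiv`; both are realisable, so `s` agrees (`GaussDiagram.rasmussenInvariant_eq_of_rEquiv_diagram`,
LeeRasmussenAntiBigonProofs.lean — Rasmussen 2010 §6 for all oriented moves incl. `Ω2c/Ω2d`, Manturov projection).
[cite: Rasmussen2010, Thm. 1] -/
theorem sliceVanishing_of_stubs
    (hR : ∀ {K K' : Knot} (P : K.RegularProjection) (P' : K'.RegularProjection),
      K.IsIsotopic K' → P.diagram.REquiv P'.diagram)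
    (hZ : ∀ K : Knot, K.IsSmoothlySlice → K.HasRasmussenInvariant 0) :
    ∀ (K : Knot) (P : K.RegularProjection), K.IsSmoothlySlice → P.diagram.rasmussenInvariant = 0 := by
  intro K P hs
  obtain ⟨K', D, hKK', ⟨P', rfl⟩, hD⟩ := hZ K hs
  rw [GaussDiagram.rasmussenInvariant_eq_of_rEquiv_diagram P P' (hR P P' hKK'), hD]

/-- Conversely v2's stub implies stub 3 (generic representatives exist, `Knot.exists_hasGaussDiagram_of_isIsotopic_holds`;
sliceness is an isotopy invariant, `Knot.IsSmoothlySlice.of_isIsotopic_holds`): stub 3 is the WEAKER half of the split.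
[cite: Rasmussen2010, Thm. 1] -/
theorem sliceHasZero_of_sliceVanishing
    (h : ∀ (K : Knot) (P : K.RegularProjection), K.IsSmoothlySlice → P.diagram.rasmussenInvariant = 0) :
    ∀ K : Knot, K.IsSmoothlySlice → K.HasRasmussenInvariant 0 := by
  intro K hs
  obtain ⟨K', G, hKK', ⟨P', rfl⟩⟩ := Knot.exists_hasGaussDiagram_of_isIsotopic_holds K
  exact ⟨K', P'.diagram, hKK', ⟨P', rfl⟩, h K' P' (Knot.IsSmoothlySlice.of_isIsotopic_holds hKK' hs)⟩

/-! ### Calibration of stubs 2 and 3 against the tree's named facts (they are facts, not costumes) -/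

/-- Stub 2 is the `→` half of the named fact `Knot.reidemeisterR` (RasmussenWellDefinedR.lean; Reidemeister 1927 +
Polyak 2010 Thm 1.2) read on regular projections. [cite: Reidemeister1927] -/
theorem stub_reidemeisterR_of_reidemeisterR (hR : Knot.reidemeisterR) :
    ∀ {K K' : Knot} (P : K.RegularProjection) (P' : K'.RegularProjection),
      K.IsIsotopic K' → P.diagram.REquiv P'.diagram :=
  fun P P' h ↦ (hR ⟨P, rfl⟩ ⟨P', rfl⟩).1 h

/-- Stub 3 is implied by Rasmussen's named fact `eq_zero_of_isSmoothlySlice` (take any generic representative,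
`Knot.exists_hasGaussDiagram_of_isIsotopic_holds`, and read its projection). [cite: Rasmussen2010, Thm. 1] -/
theorem stub_sliceHasZero_of_eq_zero_of_isSmoothlySlice (h : eq_zero_of_isSmoothlySlice) :
    ∀ K : Knot, K.IsSmoothlySlice → K.HasRasmussenInvariant 0 := by
  intro K hs
  obtain ⟨K', G, hKK', hG⟩ := Knot.exists_hasGaussDiagram_of_isIsotopic_holds K
  have hK : K.HasRasmussenInvariant G.rasmussenInvariant := ⟨K', G, hKK', hG, rfl⟩
  rwa [h hK hs] at hK

/-- Hence v2's stub — and the named fact `eq_zero_of_isSmoothlySlice` — follow from the named facts `Knot.reidemeisterR` and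
`eq_zero_of_isSmoothlySlice`… and, more to the point, from `Knot.reidemeisterR` together with stub 3 alone
(`sliceVanishing_of_stubs`): modulo Reidemeister's theorem the whole witness-tier debt of this line is stub 3.
[cite: Rasmussen2010, Thm. 1] -/
theorem sliceVanishing_of_reidemeisterR_of_sliceHasZero (hR : Knot.reidemeisterR)
    (hZ : ∀ K : Knot, K.IsSmoothlySlice → K.HasRasmussenInvariant 0) :
    ∀ (K : Knot) (P : K.RegularProjection), K.IsSmoothlySlice → P.diagram.rasmussenInvariant = 0 :=
  sliceVanishing_of_stubs (stub_reidemeisterR_of_reidemeisterR hR) hZ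

/-! ### Calibration of v2's stub: it IS the tree's named fact `eq_zero_of_isSmoothlySlice` -/

/-- v2's stub (every projection of a slice knot reads `s = 0`) implies Rasmussen's named fact `eq_zero_of_isSmoothlySlice` (the tree's reduction
`eq_zero_of_isSmoothlySlice_of_diagram`: a witness of `HasRasmussenInvariant` is a projection of an isotopic knot,
and sliceness is an isotopy invariant). [cite: Rasmussen2010, Thm. 1] -/
theorem eq_zero_of_isSmoothlySlice_of_sliceVanishing
    (h : ∀ (K : Knot) (P : K.RegularProjection), K.IsSmoothlySlice → P.diagram.rasmussenInvariant = 0) :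
    eq_zero_of_isSmoothlySlice :=
  eq_zero_of_isSmoothlySlice_of_diagram fun P hs ↦ h _ P hs

/-- Conversely the named fact implies v2's stub (a regular projection `P` of `K` witnesses
`K.HasRasmussenInvariant P.diagram.rasmussenInvariant` through the identity isotopy). [cite: Rasmussen2010, Thm. 1] -/
theorem sliceVanishing_of_eq_zero_of_isSmoothlySlice (h : eq_zero_of_isSmoothlySlice) :
    ∀ (K : Knot) (P : K.RegularProjection), K.IsSmoothlySlice → P.diagram.rasmussenInvariant = 0 :=
  fun K P hs ↦ h ⟨K, P.diagram, SphereEmbedding.IsIsotopic.refl K, ⟨P, rfl⟩, rfl⟩ hs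

/-- **Calibration**: v2's stub is equivalent to the named fact `eq_zero_of_isSmoothlySlice` (Rasmussen 2010 Thm 1,
slice case) — neither weaker (it would not close the crux) nor stronger (it is not a costume of anything open
beyond Rasmussen's theorem). [cite: Rasmussen2010, Thm. 1] -/
theorem sliceVanishing_iff_eq_zero_of_isSmoothlySlice :
    (∀ (K : Knot) (P : K.RegularProjection), K.IsSmoothlySlice → P.diagram.rasmussenInvariant = 0) ↔
      eq_zero_of_isSmoothlySlice :=
  ⟨eq_zero_of_isSmoothlySlice_of_sliceVanishing, sliceVanishing_of_eq_zero_of_isSmoothlySlice⟩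

/-! ### The composition -/

/-- **The line closes the crux**: from `stub_crux` take `(K, K', Y, s)`; `K` is smoothly slice by hypothesis; `K'` is not
smoothly slice because `K'.HasRasmussenInvariant s` with `s ≠ 0` while stubs 2 + 3 (through `sliceVanishing_of_stubs` and
`eq_zero_of_isSmoothlySlice_of_sliceVanishing`, i.e. as the named fact) say smoothly slice knots have `s = 0`. The last step
is literally the landed bridge `Theorems.zseThesis_of_crux_of_eq_zero_of_isSmoothlySlice` (p86880). -/
theorem ZseThesis_of : ZseThesis :=
  Theorems.zseThesis_of_crux_of_eq_zero_of_isSmoothlySlice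
    (eq_zero_of_isSmoothlySlice_of_sliceVanishing (sliceVanishing_of_stubs stub_reidemeisterR stub_sliceHasZero))
    stub_crux

/-! ### By-products: the certificate form of a hit (skeleton v1's `stub_hit`) still enters the line -/

/-- **A certificate-form hit proves `stub_crux`** (v1 ⇒ v2): a `0`-surgery pair with `K` RIBBON and a Gauss diagram `G'`
of `K'` itself reading `s ≠ 0` is in particular an `s`-witnessed pair in the knot-level sense `Knot.HasRasmussenInvariant`
(witnessed by `K'` and `G'` through the identity isotopy), i.e. a proof of `Literature.Uncategorized.Crux` (item 0366).
[cite: ManolescuPiccirillo2023, §1 p. 1 and Remark 1.5] -/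
theorem crux_of_hit
    (h : ∃ (K K' : Knot) (Y : Type) (_ : TopologicalSpace Y) (_ : ChartedSpace (𝔼 3) Y) (G' : GaussDiagram),
      IsIntegralSurgery (𝓡 3) Y K 0 ∧ IsIntegralSurgery (𝓡 3) Y K' 0 ∧ K.IsRibbon ∧
        K'.HasGaussDiagram G' ∧ G'.rasmussenInvariant ≠ 0) :
    Crux := by
  obtain ⟨K, K', Y, _, _, G', h1, h2, h3, h4, h5⟩ := h
  exact ⟨K, K', Y, _, _, G'.rasmussenInvariant, h1, h2, h3.isSmoothlySlice,
    ⟨K', G', SphereEmbedding.IsIsotopic.refl K', h4, rfl⟩, h5⟩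

/-- The same with `K` merely smoothly slice (the form the crux actually needs). [cite: ManolescuPiccirillo2023, §1 p. 1] -/
theorem crux_of_sliceHit
    (h : ∃ (K K' : Knot) (Y : Type) (_ : TopologicalSpace Y) (_ : ChartedSpace (𝔼 3) Y) (G' : GaussDiagram),
      IsIntegralSurgery (𝓡 3) Y K 0 ∧ IsIntegralSurgery (𝓡 3) Y K' 0 ∧ K.IsSmoothlySlice ∧
        K'.HasGaussDiagram G' ∧ G'.rasmussenInvariant ≠ 0) :
    Crux := by
  obtain ⟨K, K', Y, _, _, G', h1, h2, h3, h4, h5⟩ := h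
  exact ⟨K, K', Y, _, _, G'.rasmussenInvariant, h1, h2, h3, ⟨K', G', SphereEmbedding.IsIsotopic.refl K', h4, rfl⟩, h5⟩

/-- **Profile of the partner of a hit** (Disproof §3/§3d honoured by typing): given stub 2, a knot with a non-zero
knot-level Rasmussen invariant is not smoothly slice; hence the partner `K'` of a `stub_crux` witness is none of `K`, an
isotopic copy of `K`, nor concordant to `K` (those are slice with `K`). [cite: Rasmussen2010, Thm. 1] -/
theorem hit_partner_not_isSmoothlySlice
    (h2 : ∀ (K : Knot) (P : K.RegularProjection), K.IsSmoothlySlice → P.diagram.rasmussenInvariant = 0)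
    {K' : Knot} {s : ℤ} (h4 : K'.HasRasmussenInvariant s) (h5 : s ≠ 0) :
    ¬ K'.IsSmoothlySlice :=
  fun hs ↦ h5 (eq_zero_of_isSmoothlySlice_of_sliceVanishing h2 h4 hs)

/-- **A hit disproves the summit** through the route's assembly decl `Assembly` (PROVED in
`Theorems/ZeroSurgeryExoticAssembly.lean`: MP Lemma 3.3 + FGMW + Palais; taken here as the registered route
obligation it is, to keep this file's import cone small). -/
theorem not_smoothPoincare4_of_crux (hA : Assembly)
    (h2 : ∀ (K : Knot) (P : K.RegularProjection), K.IsSmoothlySlice → P.diagram.rasmussenInvariant = 0)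
    (hc : Crux) : ¬ _root_.SmoothPoincare4 :=
  hA (Theorems.zseThesis_of_crux_of_eq_zero_of_isSmoothlySlice (eq_zero_of_isSmoothlySlice_of_sliceVanishing h2) hc)

end Summit.SmoothPoincare4.SmoothPoincare4.Cruxes.ZseThesis.Sketch

end
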